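import Summits.ResolutionOfSingularities.ResolutionOfSingularities.Theorems.HilbertSamuelEliminationSigmaMaxModificationsCorridor3SigmaStepDefs
import Summits.ResolutionOfSingularities.ResolutionOfSingularities.Theorems.HilbertSamuelEliminationSigmaMaxModificationsCorridor3TameWildNuModPackaging
import HarnessLib

/-!
# [OURS · L1 W4.2] σ-LAYER part 2a: RUNS of a strategy — states, run-reachability, the termination dichotomy, and
# «an admissible terminating σ-run IS a ν-elimination» packaged to a `ν`-modification
# (cell res-hironaka, LADDER-RESOLUTION rung L; slot W4.2, crux chain w42 `SigmaMaxModificationsCorridor3`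
# stmt-ResolutionOfSingularities-19249 / crux stmt-…-18506; res-L1-w42-plan-1 RULINGS v3.14-5 (BO), v3.14-9 (CC)/(CD)
# 2026-08-27T09:54:20Z; hand res-D-pv-047 AS res-L1-s46-pv-10 (path announced by res-L1-type-o1 09:51:58Z, names adopted);
# `--supports stmt-ResolutionOfSingularities-19249 --as helper`)

HONEST FRAMING. OURS proof architecture over part 1 (`…Corridor3SigmaStepDefs.lean`: `Strategy`, `Strategy.cjs`,
`IsAdmissibleStrategyOn`, `Strategy.ReachableState`, the σ-near-chain vocabulary); NOTHING is a statement of H. Hironaka's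
manuscript [Hironaka2017] nor of Cossart–Jannsen–Saito; no `Theses/…` import; no named fact is introduced — the one external
input, CJS Thm. 3.10 (1) (Bennett–Hironaka–Singh), enters through the tree's PROVED `TameWild.nuMod_of_isNuElimination`.
AI-written; AI review is weaker than expert review.

## What is here (namespace `…Theorems.SigmaMaxModificationsCorridor3.Sigma`)

* §1 STATES: `Stateσ` (a stage with its bookkeeping, = `MarkedStage` minus the marked point), `Stateσ.init`,
  `MarkedStage.toState`; `Stepσ σ N ν` (σ allows `(C, P')` and the state moves to `blowup C` with the updated labels),
  `StateReachesσ` (its reflexive–transitive closure); every σ-near step is a σ-step on states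
  (`CanonicalNearStepσ.stepσ_toState`, `Reachesσ.stateReachesσ_toState`).
* §2 THE RUN-WISE SCOPE `Strategy.RunReachableState p σ N ν` (states reached from the initial state of a MAXIMAL ORIGIN of
  characteristic `p` by σ-steps on states — no marked points) and the EXPORT asked by RULINGS v3.14-9 (CC):
  `Strategy.reachableState_subset_runReachableState` (marked-reachable ⇒ run-reachable, forgetting the points), hence
  `IsAdmissibleStrategyOn.of_runReachableState : admissible on RunReachableState ⇒ admissible on ReachableState`.
  (The converse inclusion — every run-reachable state of an admissible σ carries a closed marked near chain — is the held
  «compactness port» and is NOT here.)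
* §3 RUNS: `IsRunFromσ σ N ν hW L P s` (σ-copy of the tree's `IsCanonicalRunFrom`: each centre of `s : CentreSeq W` is a step
  σ allows from the state reached before it), `IsRunσ` (from the initial state), `RunTerminatesσ` / `RunInfiniteσ`
  (σ-copies of `CanonicalSequenceTerminates` / `CanonicalSequenceInfinite`), with the transports to the CJS originals at
  `σ := Strategy.cjs R` (`isRunFromσ_cjs_iff`, `isRunσ_cjs_iff`, `runTerminatesσ_cjs_iff`, `runInfiniteσ_cjs_iff` — by
  induction along the run, the step case being part 1's `Iff.rfl`).
* §4 TOTALITY ⇒ PROLONGATION ⇒ DICHOTOMY: for σ admissible on `RunReachableState p σ N ν`, every σ-run from a run-reachable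
  state whose last `ν`-stratum is non-empty is prolonged by one (`exists_isRunFromσ_succ`), so from a maximal origin
  **`RunTerminatesσ σ N ν X ∨ RunInfiniteσ σ N ν X`** (`runTerminatesσ_or_runInfiniteσ`).
* §5 A TERMINATING ADMISSIBLE σ-RUN IS A `ν`-ELIMINATION (CJS Def. 6.14: permissible centres inside the successive
  `ν`-strata, empty last stratum — `IsRunFromσ.isNuElimination`, `exists_isNuElimination_of_runTerminatesσ`), and the
  PACKAGING `nuMod_of_runTerminatesσ : … → TameWild.NuMod Y 3 d ν` / `nuMod_or_runInfiniteσ` through the tree's unconditional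
  `TameWild.nuMod_of_isNuElimination` (CJS Thm. 3.10 (1) proved in the tree).

## Not here

The compactness port (an infinite admissible functional σ-run from a maximal origin carries an infinite CLOSED marked σ-near
chain — σ-copy of `exists_nearChain_of_canonicalSequenceInfinite_general`; HELD per RULINGS v3.14-9 (CD)); admissibility of
`Strategy.cjs R` (strata layer); any σ-row or σ-design.

## References (context)

* V. Cossart, U. Jannsen, S. Saito, LNM 2270 (2020), Rem. 6.29 (1), Def. 3.1, Def. 6.14, Thm. 3.10 (1). [CossartJannsenSaito2020]
-/

noncomputable section

set_option linter.dupNamespace false -- mandated namespace of this single-conjunct summit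

open CategoryTheory AlgebraicGeometry TopologicalSpace
open Summit.ResolutionOfSingularities.ResolutionOfSingularities.Theorems.CampaignW42
open Literature.AlgebraicGeometry.Resolution Literature.RingTheory.HilbertSamuel
open Literature.AlgebraicGeometry.CossartJannsenSaito2020
open Summit.ResolutionOfSingularities.ResolutionOfSingularities.Theorems.SigmaMaxModificationsCorridor3.Moving

namespace Summit.ResolutionOfSingularities.ResolutionOfSingularities.Theorems.SigmaMaxModificationsCorridor3.Sigma

universe u

/-- The blow-up of a locally noetherian scheme along an ideal sheaf is locally noetherian (it is proper, hence locally of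
finite type, over the base). [folklore] -/
theorem isLocallyNoetherian_blowup {W : Scheme.{u}} (hW : IsLocallyNoetherian W) (C : W.IdealSheafData) :
    IsLocallyNoetherian (blowup C) := by
  haveI : IsProper (blowup.π C) := (blowup.isBlowup C).isProper
  exact LocallyOfFiniteType.isLocallyNoetherian (blowup.π C)

/-! ## §1. States, σ-steps on states, reachability of states -/

/-- [OURS · L1 W4.2] A STATE of a run: a locally noetherian stage `W` with its bookkeeping `(L, P)` (= `MarkedStage` without
the marked point). [folklore] -/
structure Stateσ : Type (u + 1) where
  /-- the stage -/
  W : Scheme.{u}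
  /-- the stage is locally noetherian -/
  ln : IsLocallyNoetherian W
  /-- the labels of the components of the `ν`-stratum -/
  L : Labelling W
  /-- the state of the resolution cycle in progress -/
  P : Option (Pending W)

/-- [OURS · L1 W4.2] The initial state of `X`: all labels `0`, no cycle begun. [folklore] -/
def Stateσ.init (X : Scheme.{u}) (hX : IsLocallyNoetherian X) : Stateσ.{u} :=
  ⟨X, hX, Labelling.init X, none⟩

/-- [OURS · L1 W4.2] Forget the marked point. [folklore] -/
def _root_.Summit.ResolutionOfSingularities.ResolutionOfSingularities.Theorems.CampaignW42.MarkedStage.toState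
    (s : MarkedStage.{u}) : Stateσ.{u} :=
  ⟨s.W, s.ln, s.L, s.P⟩

/-- The initial marked stage forgets to the initial state. [folklore] -/
@[simp] theorem toState_init (X : Scheme.{u}) [hX : IsLocallyNoetherian X] (x : X) :
    (MarkedStage.init X x).toState = Stateσ.init X hX := rfl

/-- [OURS · L1 W4.2] ONE σ-STEP ON STATES: σ allows `(C, P')` from `(W, L, P)` and the state becomes `blowup C` with the
updated labels `L.next (W(ν)) C` and the cycle state `P'` (the point-free part of `CanonicalNearStepσ`). [folklore] -/
def Stepσ (σ : Strategy.{u}) (N : ℕ) (ν : ℕ → ℕ) (t t' : Stateσ.{u}) : Prop :=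
  ∃ (C : t.W.IdealSheafData) (P' : Option (Pending (blowup C))) (h : IsLocallyNoetherian (blowup C)),
    σ.step t.W t.ln N ν t.L t.P C P' ∧ t' = ⟨blowup C, h, t.L.next (Scheme.hsStratum t.W N ν) C, P'⟩

/-- [OURS · L1 W4.2] `t'` is reached from `t` by finitely many σ-steps on states. [folklore] -/
def StateReachesσ (σ : Strategy.{u}) (N : ℕ) (ν : ℕ → ℕ) : Stateσ.{u} → Stateσ.{u} → Prop :=
  Relation.ReflTransGen (Stepσ σ N ν)

variable {σ : Strategy.{u}} {N : ℕ} {ν : ℕ → ℕ}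

/-- A σ-near step of marked stages is a σ-step of their states. [folklore] -/
theorem CanonicalNearStepσ.stepσ_toState {s s' : MarkedStage.{u}} (h : CanonicalNearStepσ σ N ν s s') :
    Stepσ σ N ν s.toState s'.toState := by
  obtain ⟨C, P', hln, x', hstep, -, -, -, rfl⟩ := h
  exact ⟨C, P', hln, hstep, rfl⟩

/-- σ-reachability of marked stages gives σ-reachability of their states. [folklore] -/
theorem Reachesσ.stateReachesσ_toState {s s' : MarkedStage.{u}} (h : Reachesσ σ N ν s s') :
    StateReachesσ σ N ν s.toState s'.toState := by
  induction h with
  | refl => exact Relation.ReflTransGen.refl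
  | tail _ hst ih => exact ih.tail hst.stepσ_toState

/-! ## §2. The run-wise scope and the export to the marked scope (RULINGS v3.14-9 (CC)) -/

/-- [OURS · L1 W4.2] **The RUN-WISE scope: states REACHABLE BY σ-STEPS ON STATES** from the initial state of a MAXIMAL ORIGIN
of characteristic `p` at level `N`, value `ν` (`IsMaximalOrigin`; no marked points are carried). This is the scope on which the
termination dichotomy of §4 consumes admissibility. [folklore] -/
def Strategy.RunReachableState (p : ℕ) (σ : Strategy.{u}) (N : ℕ) (ν : ℕ → ℕ) :
    ∀ (W : Scheme.{u}), IsLocallyNoetherian W → Labelling W → Option (Pending W) → Prop :=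
  fun W hW L P => ∃ (X : Scheme.{u}) (hX : IsLocallyNoetherian X) (x : X),
    IsMaximalOrigin p N ν X x ∧ StateReachesσ σ N ν (Stateσ.init X hX) ⟨W, hW, L, P⟩

/-- The initial state of a maximal origin is run-reachable. [folklore] -/
theorem Strategy.runReachableState_init {p : ℕ} {X : Scheme.{u}} [hX : IsLocallyNoetherian X] {x : X}
    (hx : IsMaximalOrigin p N ν X x) :
    Strategy.RunReachableState p σ N ν X hX (Labelling.init X) none :=
  ⟨X, hX, x, hx, Relation.ReflTransGen.refl⟩

/-- Run-reachable states are stable under σ-steps. [folklore] -/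
theorem Strategy.RunReachableState.step {p : ℕ} {W : Scheme.{u}} {hW : IsLocallyNoetherian W} {L : Labelling W}
    {P : Option (Pending W)} (h : Strategy.RunReachableState p σ N ν W hW L P) {C : W.IdealSheafData}
    {P' : Option (Pending (blowup C))} (hstep : σ.step W hW N ν L P C P') (h' : IsLocallyNoetherian (blowup C)) :
    Strategy.RunReachableState p σ N ν (blowup C) h' (L.next (Scheme.hsStratum W N ν) C) P' := by
  obtain ⟨X, hX, x, hx, hreach⟩ := h
  exact ⟨X, hX, x, hx, hreach.tail ⟨C, P', h', hstep, rfl⟩⟩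

/-- **Marked-reachable states are run-reachable** (forget the marked points): `ReachableState p σ N ν ⊆ RunReachableState p σ N ν`.
[folklore] -/
theorem Strategy.reachableState_subset_runReachableState {p : ℕ} {W : Scheme.{u}} {hW : IsLocallyNoetherian W}
    {L : Labelling W} {P : Option (Pending W)} (h : Strategy.ReachableState p σ N ν W hW L P) :
    Strategy.RunReachableState p σ N ν W hW L P := by
  obtain ⟨x, X, hX, x₀, hx₀, hreach⟩ := h
  exact ⟨X, hX, x₀, hx₀, hreach.stateReachesσ_toState⟩

/-- **EXPORT (RULINGS v3.14-9 (CC))**: admissibility on the run-wise scope gives admissibility on the marked scope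
`Strategy.ReachableState p σ N ν` of the σ-rows. [folklore] -/
theorem IsAdmissibleStrategyOn.of_runReachableState {p : ℕ}
    (h : IsAdmissibleStrategyOn (Strategy.RunReachableState p σ N ν) N ν σ) :
    IsAdmissibleStrategyOn (Strategy.ReachableState p σ N ν) N ν σ :=
  h.mono fun _ _ _ _ hP => Strategy.reachableState_subset_runReachableState hP

/-! ## §3. Runs of a strategy -/

/-- [OURS · L1 W4.2] **`s` is a σ-RUN from the stage `W` (locally noetherian by `hW`) in the state `(L, P)`**: each centre of
`s : CentreSeq W` is allowed by σ from the state reached before it, the bookkeeping being updated at every blow-up by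
`Labelling.next` (σ-copy of the tree's `IsCanonicalRunFrom`). [folklore] -/
def IsRunFromσ (σ : Strategy.{u}) (N : ℕ) (ν : ℕ → ℕ) :
    ∀ {W : Scheme.{u}} (_ : IsLocallyNoetherian W), Labelling W → Option (Pending W) → CentreSeq W → Prop
  | _, _, _, _, CentreSeq.nil _ => True
  | W, hW, L, P, CentreSeq.cons C rest =>
      ∃ P', σ.step W hW N ν L P C P' ∧
        IsRunFromσ σ N ν (isLocallyNoetherian_blowup hW C) (L.next (Scheme.hsStratum W N ν) C) P' rest

/-- Unfolding: the empty run. [folklore] -/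
@[simp] theorem isRunFromσ_nil {W : Scheme.{u}} (hW : IsLocallyNoetherian W) (L : Labelling W)
    (P : Option (Pending W)) : IsRunFromσ σ N ν hW L P (CentreSeq.nil W) := trivial

/-- Unfolding: a run with a first centre. [folklore] -/
theorem isRunFromσ_cons_iff {W : Scheme.{u}} (hW : IsLocallyNoetherian W) (L : Labelling W) (P : Option (Pending W))
    (C : W.IdealSheafData) (rest : CentreSeq (blowup C)) :
    IsRunFromσ σ N ν hW L P (CentreSeq.cons C rest) ↔
      ∃ P', σ.step W hW N ν L P C P' ∧
        IsRunFromσ σ N ν (isLocallyNoetherian_blowup hW C) (L.next (Scheme.hsStratum W N ν) C) P' rest :=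
  Iff.rfl

/-- [OURS · L1 W4.2] **`s` is a σ-run from the INITIAL state of `X`** (all labels `0`, no cycle begun; σ-copy of
`CentreSeq.IsCanonicalRun`). [folklore] -/
def IsRunσ (σ : Strategy.{u}) (N : ℕ) (ν : ℕ → ℕ) {X : Scheme.{u}} [hX : IsLocallyNoetherian X]
    (s : CentreSeq X) : Prop :=
  IsRunFromσ σ N ν hX (Labelling.init X) none s

/-- [OURS · L1 W4.2] **The σ-run from `X` TERMINATES**: some σ-run from the initial state ends with an empty `ν`-stratum
(σ-copy of `CanonicalSequenceTerminates`). [folklore] -/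
def RunTerminatesσ (σ : Strategy.{u}) (N : ℕ) (ν : ℕ → ℕ) (X : Scheme.{u}) [IsLocallyNoetherian X] : Prop :=
  ∃ s : CentreSeq X, IsRunσ σ N ν s ∧ Scheme.hsStratum s.top N ν = ∅

/-- [OURS · L1 W4.2] **The σ-runs from `X` go on for ever**: σ-runs of every length from the initial state (σ-copy of
`CanonicalSequenceInfinite`). [folklore] -/
def RunInfiniteσ (σ : Strategy.{u}) (N : ℕ) (ν : ℕ → ℕ) (X : Scheme.{u}) [IsLocallyNoetherian X] : Prop :=
  ∀ n : ℕ, ∃ s : CentreSeq X, IsRunσ σ N ν s ∧ s.length = n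

section Transport

variable (R : ∀ S : Scheme.{u}, CentreSeq S → Prop) (N : ℕ) (ν : ℕ → ℕ)

/-- `IsRunFromσ (σ_CJS R) = IsCanonicalRunFrom R` (induction along the run; the step case is part 1's `Iff.rfl`). [folklore] -/
theorem isRunFromσ_cjs_iff : ∀ {W : Scheme.{u}} (hW : IsLocallyNoetherian W) (L : Labelling W) (P : Option (Pending W))
    (s : CentreSeq W), IsRunFromσ (Strategy.cjs R) N ν hW L P s ↔ IsCanonicalRunFrom R N ν L P s
  | _, _, _, _, CentreSeq.nil _ => Iff.rfl
  | W, hW, L, P, CentreSeq.cons C rest => by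
    rw [isRunFromσ_cons_iff]
    exact exists_congr fun P' => and_congr Iff.rfl (isRunFromσ_cjs_iff _ _ P' rest)

/-- `IsRunσ (σ_CJS R) = IsCanonicalRun R`. [folklore] -/
theorem isRunσ_cjs_iff {X : Scheme.{u}} [IsLocallyNoetherian X] (s : CentreSeq X) :
    IsRunσ (Strategy.cjs R) N ν s ↔ s.IsCanonicalRun R N ν :=
  isRunFromσ_cjs_iff R N ν _ _ _ s

/-- `RunTerminatesσ (σ_CJS R) = CanonicalSequenceTerminates R`. [folklore] -/
theorem runTerminatesσ_cjs_iff (X : Scheme.{u}) [IsLocallyNoetherian X] :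
    RunTerminatesσ (Strategy.cjs R) N ν X ↔ CanonicalSequenceTerminates R N ν X := by
  refine exists_congr fun s => and_congr (isRunσ_cjs_iff R N ν s) Iff.rfl

/-- `RunInfiniteσ (σ_CJS R) = CanonicalSequenceInfinite R`. [folklore] -/
theorem runInfiniteσ_cjs_iff (X : Scheme.{u}) [IsLocallyNoetherian X] :
    RunInfiniteσ (Strategy.cjs R) N ν X ↔ CanonicalSequenceInfinite R N ν X := by
  refine forall_congr' fun n => exists_congr fun s => and_congr (isRunσ_cjs_iff R N ν s) Iff.rfl

end Transport

/-! ## §4. Totality on the run-wise scope: prolongation and the termination dichotomy -/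

/-- **EVERY σ-RUN FROM A RUN-REACHABLE STATE WITH NON-EMPTY LAST `ν`-STRATUM IS PROLONGED** when σ is admissible (total) on
the run-wise scope: induction along the run, run-reachability propagating along σ-steps. [folklore] -/
theorem exists_isRunFromσ_succ {p : ℕ} (hadm : IsAdmissibleStrategyOn (Strategy.RunReachableState p σ N ν) N ν σ) :
    ∀ {W : Scheme.{u}} (hW : IsLocallyNoetherian W) (L : Labelling W) (P : Option (Pending W)),
      Strategy.RunReachableState p σ N ν W hW L P →
        ∀ (s : CentreSeq W), IsRunFromσ σ N ν hW L P s → (Scheme.hsStratum s.top N ν).Nonempty →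
          ∃ s' : CentreSeq W, IsRunFromσ σ N ν hW L P s' ∧ s'.length = s.length + 1
  | W, hW, L, P, hr, CentreSeq.nil _, _, hY => by
    obtain ⟨C, P', hst⟩ := (hadm W hW L P hr).2 hY
    exact ⟨CentreSeq.cons C (CentreSeq.nil _), ⟨P', hst, trivial⟩, rfl⟩
  | W, hW, L, P, hr, CentreSeq.cons C rest, hs, hY => by
    obtain ⟨P', hst, hrest⟩ := hs
    obtain ⟨rest', hrest', hlen⟩ :=
      exists_isRunFromσ_succ hadm _ _ P' (hr.step hst _) rest hrest hY
    exact ⟨CentreSeq.cons C rest', ⟨P', hst, hrest'⟩, by simp [hlen]⟩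

/-- **THE TERMINATION DICHOTOMY**: for σ admissible on the run-wise scope and `X` carrying a maximal origin of characteristic
`p`, either some σ-run from `X` ends with an empty `ν`-stratum or σ-runs of every length exist. [folklore] -/
theorem runTerminatesσ_or_runInfiniteσ {p : ℕ} (hadm : IsAdmissibleStrategyOn (Strategy.RunReachableState p σ N ν) N ν σ)
    {X : Scheme.{u}} [hX : IsLocallyNoetherian X] {x : X} (hx : IsMaximalOrigin p N ν X x) :
    RunTerminatesσ σ N ν X ∨ RunInfiniteσ σ N ν X := by
  classical
  by_cases hinf : RunInfiniteσ σ N ν X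
  · exact Or.inr hinf
  left
  have hex : ∃ n, ¬ ∃ s : CentreSeq X, IsRunσ σ N ν s ∧ s.length = n := not_forall.mp hinf
  have hn₀ : ¬ ∃ s : CentreSeq X, IsRunσ σ N ν s ∧ s.length = Nat.find hex := Nat.find_spec hex
  have hpos : Nat.find hex ≠ 0 := by
    intro h0
    exact hn₀ ⟨CentreSeq.nil X, trivial, by rw [h0]; rfl⟩
  obtain ⟨m, hm⟩ := Nat.exists_eq_succ_of_ne_zero hpos
  have hm' : ∃ s : CentreSeq X, IsRunσ σ N ν s ∧ s.length = m :=
    not_not.mp (Nat.find_min hex (show m < Nat.find hex by omega))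
  obtain ⟨s, hs, hlen⟩ := hm'
  by_cases hY : (Scheme.hsStratum s.top N ν).Nonempty
  · obtain ⟨s', hs', hlen'⟩ :=
      exists_isRunFromσ_succ hadm hX _ _ (Strategy.runReachableState_init hx) s hs hY
    exact absurd ⟨s', hs', by rw [hlen', hlen, hm]⟩ hn₀
  · exact ⟨s, hs, Set.not_nonempty_iff_eq_empty.mp hY⟩

/-! ## §5. A terminating admissible σ-run is a `ν`-elimination; packaging to a `ν`-modification -/

/-- **AN ADMISSIBLE σ-RUN ENDING WITH AN EMPTY `ν`-STRATUM IS A `ν`-ELIMINATION** (CJS Def. 6.14): along a run from a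
run-reachable state every centre is permissible and lies in the `ν`-stratum of its own stage (clause (a) of admissibility at the
successive — run-reachable — states). [cite: CossartJannsenSaito2020, Def. 6.14] -/
theorem IsRunFromσ.isNuElimination {p : ℕ} (hadm : IsAdmissibleStrategyOn (Strategy.RunReachableState p σ N ν) N ν σ) :
    ∀ {W : Scheme.{u}} (hW : IsLocallyNoetherian W) (L : Labelling W) (P : Option (Pending W)),
      Strategy.RunReachableState p σ N ν W hW L P →
        ∀ (s : CentreSeq W), IsRunFromσ σ N ν hW L P s → Scheme.hsStratum s.top N ν = ∅ → s.IsNuElimination N ν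
  | W, hW, L, P, _, CentreSeq.nil _, _, hY => ⟨trivial, trivial, hY⟩
  | W, hW, L, P, hr, CentreSeq.cons C rest, hs, hY => by
    obtain ⟨P', hst, hrest⟩ := hs
    obtain ⟨hperm, hsub, -⟩ := (hadm W hW L P hr).1 C P' hst
    obtain ⟨hperm', hstr', htop'⟩ := IsRunFromσ.isNuElimination hadm _ _ P' (hr.step hst _) rest hrest hY
    exact ⟨⟨hperm, hperm'⟩, ⟨hsub, hstr'⟩, htop'⟩

/-- **A TERMINATING σ-RUN FROM A MAXIMAL ORIGIN YIELDS A `ν`-ELIMINATION OF `X`** (σ admissible on the run-wise scope) — the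
σ-side TARGET of RULINGS v3.14-5 (BL): `∃ s : CentreSeq X, s.IsNuElimination N ν`. [cite: CossartJannsenSaito2020, Def. 6.14] -/
theorem exists_isNuElimination_of_runTerminatesσ {p : ℕ}
    (hadm : IsAdmissibleStrategyOn (Strategy.RunReachableState p σ N ν) N ν σ)
    {X : Scheme.{u}} [hX : IsLocallyNoetherian X] {x : X} (hx : IsMaximalOrigin p N ν X x)
    (h : RunTerminatesσ σ N ν X) : ∃ s : CentreSeq X, s.IsNuElimination N ν := by
  obtain ⟨s, hs, hY⟩ := h
  exact ⟨s, IsRunFromσ.isNuElimination hadm hX _ _ (Strategy.runReachableState_init hx) s hs hY⟩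

/-- **PACKAGING: a terminating admissible σ-run from a maximal origin of a threefold datum gives the line's `ν`-MODIFICATION**
`TameWild.NuMod Y 3 d ν` (`d ≥ dim Y`), through the tree's unconditional `TameWild.nuMod_of_isNuElimination` (CJS Thm. 3.10 (1)
PROVED in the tree: permissible blow-ups do not raise `H^N`). The structure morphism, reducedness, `dim Y ≤ 3` and the
maximality of `ν` are read off `IsMaximalOrigin p 3 ν Y y`. [cite: CossartJannsenSaito2020, Def. 6.14, Thm. 3.10 (1)] -/
theorem nuMod_of_runTerminatesσ {p : ℕ} {σ : Strategy.{0}} {ν : ℕ → ℕ}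
    (hadm : IsAdmissibleStrategyOn (Strategy.RunReachableState p σ 3 ν) 3 ν σ)
    {Y : Scheme.{0}} [IsLocallyNoetherian Y] {y : Y} (hy : IsMaximalOrigin p 3 ν Y y) {d : ℕ}
    (hd : topologicalKrullDim Y ≤ (d : WithBot ℕ∞)) (h : RunTerminatesσ σ 3 ν Y) : TameWild.NuMod Y 3 d ν := by
  obtain ⟨s, hs⟩ := exists_isNuElimination_of_runTerminatesσ hadm hy h
  obtain ⟨k, _, _, g, -, hft, -⟩ := hy.exists_structure
  haveI := hft
  haveI := hy.isReduced
  exact TameWild.nuMod_of_isNuElimination g hd hy.dim_le hy.maximal s hs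

/-- **THE DICHOTOMY, PACKAGED**: for σ admissible on the run-wise scope of a threefold maximal-origin datum `(Y, ν)`, either the
line's `ν`-modification exists or σ runs for ever from `Y`. [cite: CossartJannsenSaito2020, Def. 6.14, Thm. 3.10 (1)] -/
theorem nuMod_or_runInfiniteσ {p : ℕ} {σ : Strategy.{0}} {ν : ℕ → ℕ}
    (hadm : IsAdmissibleStrategyOn (Strategy.RunReachableState p σ 3 ν) 3 ν σ)
    {Y : Scheme.{0}} [IsLocallyNoetherian Y] {y : Y} (hy : IsMaximalOrigin p 3 ν Y y) {d : ℕ}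
    (hd : topologicalKrullDim Y ≤ (d : WithBot ℕ∞)) : TameWild.NuMod Y 3 d ν ∨ RunInfiniteσ σ 3 ν Y := by
  rcases runTerminatesσ_or_runInfiniteσ hadm hy with h | h
  · exact Or.inl (nuMod_of_runTerminatesσ hadm hy hd h)
  · exact Or.inr h

end Summit.ResolutionOfSingularities.ResolutionOfSingularities.Theorems.SigmaMaxModificationsCorridor3.Sigma

end
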